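import Mathlib
import HarnessLib
import Summits.Ventures.LatticeQCDFlow.Exactness.NCMCGeneralSpaceTauIntWindowConsistency

/-!
# The interval form: `P_{μ₀}{ |x̄_N − πf| ≤ z √(Γ̂_N(0) · 2 τ̂_{N,W_N} / N) } → N(0,1)([−z, z])` — the printed Γ-method interval `x̄_N ± z √(2 τ̂ Γ̂(0)/N)` CONTAINS `πf` with asymptotically nominal probability, from every initial law

HONEST FRAMING: exact (Metropolis-corrected) sampling algorithms for lattice gauge theory;
figures of merit are autocorrelation/cost numbers at stated couplings and volumes; no
continuum-physics claim.

Venture `LatticeQCDFlow` (cell pub-lqcd), topic `Exactness`; FANOUT row 13 (`eng-snf`, GEN-20).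
NEW WORK of the cell, not a published result; no definition is introduced; nothing is cited as a
fact.  `NCMCGeneralSpaceGammaMethodStudentizedCLT.lean` states exact asymptotic coverage through the
studentized statistic, `P{|(√N)⁻¹ Σ_{t<N}(f(X_t) − πf) · (√σ̂²_N)⁻¹| ≤ z} → N(0,1)([−z, z])`
(`σ̂²_N = Γ̂_N(0) · 2 τ̂_{N,W_N}`, scorer A's Γ-method variance).  What a reader checks is the INTERVAL
statement "`πf ∈ x̄_N ± z √(σ̂²_N/N)`".  The two events coincide on every path with `N ≥ 1` and
`σ̂²_N > 0`; on `{σ̂²_N ≤ 0}` (where Lean's `(√·)⁻¹ = 0` makes the studentized event trivially true and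
the interval degenerate) they may differ — but that event has probability tending to zero because
`σ̂²_N → σ²_f > 0` in probability.  THIS FILE records the squeeze (`|P(F_N) − P(E_N)| ≤ P(B_N) → 0`) and
the interval-form coverage theorem, from EVERY initial law under a Doeblin power; and the same for
the NCMC lane's printed `dF_occ ± z √(2 τ̂_n/(n p̂(1 − p̂)))` from every initial state (the vanishing
event is `{τ̂_n ≤ 0} ∪ {p̂_n ∈ {0,1}}`, controlled by the consistency of `τ̂_n` for `τ_int(ρ_occ) > 0`
— `NCMCGeneralSpaceTauIntWindowConsistency` — and the every-start law of large numbers of the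
occupancy).

## Content

* `tendsto_measure_of_eq_off_vanishing` — if `P(B_n) → 0`, `E_n ∩ B_nᶜ = F_n ∩ B_nᶜ` and
  `P(E_n) → L` then `P(F_n) → L` (probability measure, `ℝ≥0∞`-valued).
* `abs_studentized_le_iff` — for `N ≥ 1`, `v > 0`:
  `|(√N)⁻¹ S · (√v)⁻¹| ≤ z ↔ |S/N| ≤ z √(v/N)`.
* `abs_scaled_le_iff` — for `n ≥ 1`, `a > 0`, `τ > 0`: `|√n D √(a/(2τ))| ≤ z ↔ |D| ≤ z √(2τ/(n a))`.
* **`tendsto_measure_mean_mem_gammaInterval_of_nHit`** — `κ` Markov, `π` invariant,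
  `(nHit κ m)(z,·) ≥ ε ν` (`ε ≠ 0`, `0 < m`), `|f| ≤ C`, `σ²_f > 0`, `W_N → ∞`, `W_N³/N → 0`, `z > 0`,
  EVERY `μ₀`:
  `P_{μ₀}{ |x̄_N − πf| ≤ z √(Γ̂_N(0) · 2 τ̂_{N,W_N} / N) } → gaussianReal 0 1 (Icc (−z) z)`.
* **`CrooksPair.ncmc_dFocc_mem_gammaInterval_of_sq`** — THE NCMC LANE, interval form, from EVERY
  initial state under the two-step certificate (`τ_int(ρ_occ) > 0`):
  `P_{δ_{z₀}}{ |dF_occ,n − ΔF| ≤ z √(2 τ̂_n / (n p̂_n(1 − p̂_n))) } → gaussianReal 0 1 (Icc (−z) z)`.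

NOT CLAIMED: the automatic window; finite-`N` coverage; any number of ours.
-/

namespace Summit.Ventures.LatticeQCDFlow.Exactness.GeneralNCMC

open MeasureTheory ProbabilityTheory Set Filter Finset
open scoped ENNReal NNReal Topology

/-! ## §1 Two lemmas -/

section Lemmas

variable {Ω₀ : Type*} [MeasurableSpace Ω₀] {P : Measure Ω₀} [IsProbabilityMeasure P]

/-- **Squeeze across events that agree off a vanishing event**: if `P(B_n) → 0`,
`E_n ∩ B_nᶜ = F_n ∩ B_nᶜ` for all `n` and `P(E_n) → L`, then `P(F_n) → L`. -/
theorem tendsto_measure_of_eq_off_vanishing {E F B : ℕ → Set Ω₀} {L : ℝ≥0∞}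
    (hB : Tendsto (fun n => P (B n)) atTop (𝓝 0)) (heq : ∀ n, E n ∩ (B n)ᶜ = F n ∩ (B n)ᶜ)
    (hE : Tendsto (fun n => P (E n)) atTop (𝓝 L)) :
    Tendsto (fun n => P (F n)) atTop (𝓝 L) := by
  have hL : L ≠ ∞ := by
    refine ne_top_of_le_ne_top ENNReal.one_ne_top (le_of_tendsto' hE fun n => prob_le_one)
  -- `P(F_n) ≤ P(E_n) + P(B_n)` and `P(E_n) ≤ P(F_n) + P(B_n)`
  have hFE : ∀ n, P (F n) ≤ P (E n) + P (B n) := by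
    intro n
    calc P (F n) ≤ P ((F n ∩ (B n)ᶜ) ∪ B n) := measure_mono fun x hx => by
          by_cases hb : x ∈ B n
          · exact Or.inr hb
          · exact Or.inl ⟨hx, hb⟩
      _ ≤ P (F n ∩ (B n)ᶜ) + P (B n) := measure_union_le _ _
      _ = P (E n ∩ (B n)ᶜ) + P (B n) := by rw [heq n]
      _ ≤ P (E n) + P (B n) := by gcongr; exact Set.inter_subset_left
  have hEF : ∀ n, P (E n) ≤ P (F n) + P (B n) := by
    intro n
    calc P (E n) ≤ P ((E n ∩ (B n)ᶜ) ∪ B n) := measure_mono fun x hx => by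
          by_cases hb : x ∈ B n
          · exact Or.inr hb
          · exact Or.inl ⟨hx, hb⟩
      _ ≤ P (E n ∩ (B n)ᶜ) + P (B n) := measure_union_le _ _
      _ = P (F n ∩ (B n)ᶜ) + P (B n) := by rw [heq n]
      _ ≤ P (F n) + P (B n) := by gcongr; exact Set.inter_subset_left
  have hup : Tendsto (fun n => P (E n) + P (B n)) atTop (𝓝 L) := by
    simpa using hE.add hB
  have hlow : Tendsto (fun n => P (E n) - P (B n)) atTop (𝓝 L) := by
    have h := ENNReal.Tendsto.sub hE hB (Or.inl hL)
    simpa using h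
  refine tendsto_of_tendsto_of_tendsto_of_le_of_le hlow hup (fun n => ?_) (fun n => hFE n)
  exact tsub_le_iff_right.2 (hEF n)

/-- **The studentized event IS the interval event** when `N ≥ 1` and the variance statistic is
positive: `|(√N)⁻¹ S · (√v)⁻¹| ≤ z ↔ |S/N| ≤ z √(v/N)`. -/
theorem abs_studentized_le_iff {N : ℕ} (hN : 0 < N) {S v z : ℝ} (hv : 0 < v) :
    |(Real.sqrt N)⁻¹ * S * (Real.sqrt v)⁻¹| ≤ z ↔ |S / N| ≤ z * Real.sqrt (v / N) := by
  have hN' : (0 : ℝ) < N := by exact_mod_cast hN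
  have hsN : 0 < Real.sqrt N := Real.sqrt_pos.2 hN'
  have hsv : 0 < Real.sqrt v := Real.sqrt_pos.2 hv
  have hk : Real.sqrt v / Real.sqrt N * (N : ℝ) = Real.sqrt N * Real.sqrt v := by
    rw [div_mul_eq_mul_div, div_eq_iff hsN.ne', mul_comm (Real.sqrt N) (Real.sqrt v), mul_assoc,
      Real.mul_self_sqrt hN'.le]
  rw [Real.sqrt_div' v hN'.le, abs_mul, abs_mul, abs_inv, abs_inv, abs_of_pos hsN, abs_of_pos hsv,
    abs_div, abs_of_pos hN']
  rw [show (Real.sqrt N)⁻¹ * |S| * (Real.sqrt v)⁻¹ = |S| / (Real.sqrt N * Real.sqrt v) by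
      field_simp, div_le_iff₀ (mul_pos hsN hsv), div_le_iff₀ hN',
    mul_assoc z (Real.sqrt v / Real.sqrt N), hk]

/-- **The NCMC studentized event IS the interval event** when `n ≥ 1`, `a = p̂(1 − p̂) > 0` and
`τ̂ > 0`: `|√n D · √(a/(2τ̂))| ≤ z ↔ |D| ≤ z √(2τ̂/(n a))`. -/
theorem abs_scaled_le_iff {n : ℕ} (hn : 0 < n) {D a τ z : ℝ} (ha : 0 < a) (hτ : 0 < τ) :
    |Real.sqrt n * D * Real.sqrt (a / (2 * τ))| ≤ z ↔ |D| ≤ z * Real.sqrt (2 * τ / (n * a)) := by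
  have hn' : (0 : ℝ) < n := by exact_mod_cast hn
  have hq : 0 < Real.sqrt n * Real.sqrt (a / (2 * τ)) :=
    mul_pos (Real.sqrt_pos.2 hn') (Real.sqrt_pos.2 (by positivity))
  have hinv : Real.sqrt (2 * τ / (n * a)) = (Real.sqrt n * Real.sqrt (a / (2 * τ)))⁻¹ := by
    rw [← Real.sqrt_mul hn'.le, ← Real.sqrt_inv]
    congr 1
    field_simp
  rw [hinv, show Real.sqrt n * D * Real.sqrt (a / (2 * τ)) = D * (Real.sqrt n * Real.sqrt (a / (2 * τ)))
    by ring, abs_mul, abs_of_pos hq, ← div_eq_mul_inv, le_div_iff₀ hq]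

end Lemmas

/-! ## §2 The interval-form coverage theorem -/

section Chain

variable {S : Type*} [MeasurableSpace S]
  {κ : Kernel S S} [IsMarkovKernel κ] {π : Measure S} [IsProbabilityMeasure π]
  {ν : Measure S} [IsProbabilityMeasure ν] {ε : ℝ≥0∞} {m : ℕ}
  (μ₀ : Measure S) [IsProbabilityMeasure μ₀]

/-- **THE PRINTED Γ-METHOD INTERVAL CONTAINS `πf` WITH ASYMPTOTICALLY NOMINAL PROBABILITY, FROM EVERY
INITIAL LAW.**  `κ` Markov, `π` invariant, `(nHit κ m)(z,·) ≥ ε ν` (`ε ≠ 0`, `0 < m`), `|f| ≤ C`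
measurable with `σ²_f > 0`; windows `W_N → ∞`, `W_N³/N → 0`; `z > 0`.  Then
`P_{μ₀}{ |x̄_N − πf| ≤ z √(Γ̂_N(0) · 2 τ̂_{N,W_N} / N) } → gaussianReal 0 1 (Icc (−z) z)`. -/
theorem tendsto_measure_mean_mem_gammaInterval_of_nHit (hπ : Kernel.Invariant κ π)
    (hε : ε ≠ 0) (hmin : ∀ z, ε • ν ≤ nHit κ m z) (hm : 0 < m)
    {f : S → ℝ} (hf : Measurable f) {C : ℝ} (hC : ∀ x, |f x| ≤ C)
    (hσ : 0 < Scoring.autocov κ π (fun y => f y - ∫ z, f z ∂π) 0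
        + 2 * ∑' t, Scoring.autocov κ π (fun y => f y - ∫ z, f z ∂π) (t + 1))
    {W : ℕ → ℕ} (hW : Tendsto W atTop atTop) (hW3 : Tendsto (fun N => (W N : ℝ) ^ 3 / N) atTop (𝓝 0))
    {z : ℝ} (hz : 0 < z)
    [IsProbabilityMeasure (Kernel.trajMeasure (X := fun _ : ℕ => S) μ₀
        (fun n : ℕ => κ.comap (fun hh : (i : ↥(Finset.Iic n)) → S => hh ⟨n, Finset.mem_Iic.2 le_rfl⟩)
          (measurable_pi_apply _)))] :
    Tendsto (fun N : ℕ => (Kernel.trajMeasure (X := fun _ : ℕ => S) μ₀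
        (fun n : ℕ => κ.comap (fun hh : (i : ↥(Finset.Iic n)) → S => hh ⟨n, Finset.mem_Iic.2 le_rfl⟩)
          (measurable_pi_apply _)))
        {x : ℕ → S | |(∑ t ∈ range N, f (x t)) / N - ∫ z, f z ∂π|
          ≤ z * Real.sqrt (Scoring.gammaHat (fun i => f (x i)) N 0
            * (2 * Scoring.tauIntWindow (Scoring.rhoHat (fun i => f (x i)) N) (W N)) / N)})
      atTop (𝓝 (gaussianReal 0 1 (Icc (-z) z))) := by
  set P := Kernel.trajMeasure (X := fun _ : ℕ => S) μ₀
      (fun n : ℕ => κ.comap (fun hh : (i : ↥(Finset.Iic n)) → S => hh ⟨n, Finset.mem_Iic.2 le_rfl⟩)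
        (measurable_pi_apply _)) with hP
  haveI : Nonempty S := nonempty_of_isProbabilityMeasure μ₀
  have hε1 : ε ≤ 1 := by
    haveI := isMarkovKernel_nHit κ m
    exact eps_le_one_of_minorised hmin
  set c := ∫ z, f z ∂π with hc
  set σ2 := Scoring.autocov κ π (fun y => f y - c) 0
    + 2 * ∑' t, Scoring.autocov κ π (fun y => f y - c) (t + 1) with hσ2
  -- the studentized coverage
  have hE := tendsto_measure_studentized_timeAverage_le_of_nHit μ₀ hπ hε hmin hm hf hC hσ hW hW3 hz
  rw [← hP] at hE
  -- the variance statistic converges in probability to `σ² > 0`, so `{σ̂² ≤ 0} ∪ {N = 0}` vanishes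
  have hcons := chain_gammaWindow_tendstoInMeasure_of_nHit μ₀ (fun z B hB => minorised_setwise hmin z hB)
    (pos_iff_ne_zero.2 hε) hε1 hm hπ hf hC hW hW3
  rw [← hP] at hcons
  set V : ℕ → (ℕ → S) → ℝ := fun N x => Scoring.gammaHat (fun i => f (x i)) N 0
    * (2 * Scoring.tauIntWindow (Scoring.rhoHat (fun i => f (x i)) N) (W N)) with hV
  set B : ℕ → Set (ℕ → S) := fun N => {x | V N x ≤ 0} ∪ {x | N = 0} with hBdef
  have hBt : Tendsto (fun N => P (B N)) atTop (𝓝 0) := by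
    have h1 : Tendsto (fun N => P {x | V N x ≤ 0}) atTop (𝓝 0) := by
      have h := hcons (ENNReal.ofReal σ2) (by simpa using hσ)
      refine tendsto_of_tendsto_of_tendsto_of_le_of_le tendsto_const_nhds h (fun N => bot_le)
        fun N => measure_mono fun x hx => ?_
      simp only [Set.mem_setOf_eq] at hx ⊢
      rw [edist_dist, Real.dist_eq]
      refine ENNReal.ofReal_le_ofReal ?_
      rw [show V N x = Scoring.gammaHat (fun i => f (x i)) N 0
          * (2 * Scoring.tauIntWindow (Scoring.rhoHat (fun i => f (x i)) N) (W N)) from rfl] at hx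
      rw [abs_sub_comm]
      linarith [le_abs_self (σ2 - Scoring.gammaHat (fun i => f (x i)) N 0
        * (2 * Scoring.tauIntWindow (Scoring.rhoHat (fun i => f (x i)) N) (W N)))]
    have h2 : Tendsto (fun N : ℕ => P {x : ℕ → S | N = 0}) atTop (𝓝 0) := by
      refine tendsto_const_nhds.congr' ?_
      filter_upwards [Filter.eventually_gt_atTop 0] with N hN
      rw [show {x : ℕ → S | N = 0} = ∅ from Set.eq_empty_of_forall_notMem fun x hx => hN.ne' hx,
        measure_empty]
    have h := h1.add h2
    rw [add_zero] at h
    exact tendsto_of_tendsto_of_tendsto_of_le_of_le tendsto_const_nhds h (fun N => bot_le)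
      fun N => measure_union_le _ _
  refine tendsto_measure_of_eq_off_vanishing hBt (fun N => ?_) hE
  ext x
  simp only [hBdef, Set.mem_inter_iff, Set.mem_compl_iff, Set.mem_union, Set.mem_setOf_eq, not_or,
    not_le]
  constructor
  · rintro ⟨h, hVpos, hN⟩
    refine ⟨?_, hVpos, hN⟩
    have hN0 : 0 < N := Nat.pos_of_ne_zero hN
    have key := (abs_studentized_le_iff hN0 (S := ∑ t ∈ range N, (f (x t) - c)) (z := z) hVpos).1
    have hsum : (∑ t ∈ range N, (f (x t) - c)) / N = (∑ t ∈ range N, f (x t)) / N - c := by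
      rw [Finset.sum_sub_distrib, Finset.sum_const, Finset.card_range, nsmul_eq_mul]
      have hN' : (N : ℝ) ≠ 0 := by exact_mod_cast hN
      field_simp
    rw [hsum] at key
    exact key (by simpa [mul_assoc] using h)
  · rintro ⟨h, hVpos, hN⟩
    refine ⟨?_, hVpos, hN⟩
    have hN0 : 0 < N := Nat.pos_of_ne_zero hN
    have key := (abs_studentized_le_iff hN0 (S := ∑ t ∈ range N, (f (x t) - c)) (z := z) hVpos).2
    have hsum : (∑ t ∈ range N, (f (x t) - c)) / N = (∑ t ∈ range N, f (x t)) / N - c := by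
      rw [Finset.sum_sub_distrib, Finset.sum_const, Finset.card_range, nsmul_eq_mul]
      have hN' : (N : ℝ) ≠ 0 := by exact_mod_cast hN
      field_simp
    rw [hsum] at key
    simpa [mul_assoc] using key h

end Chain

/-! ## §3 The NCMC lane: the printed `dF_occ` interval with the Γ-method `τ̂` -/

section NCMC

variable {Ω E : Type*} [MeasurableSpace Ω] [MeasurableSpace E]
  {ν₀ ν₁ : Measure Ω} [IsFiniteMeasure ν₀] [IsFiniteMeasure ν₁]
  {κF κR : Kernel Ω E} [IsMarkovKernel κF] [IsMarkovKernel κR] {s e : E → Ω} {W : E → ℝ} {c : ℝ}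
  {T₀ T₁ : Kernel Ω Ω} [IsMarkovKernel T₀] [IsMarkovKernel T₁] {ε : ℝ≥0∞}
  {ν : Measure (Bool × Ω)} [IsProbabilityMeasure ν]

/-- **THE NCMC LANE, INTERVAL FORM: `ΔF ∈ dF_occ,n ± z √(2 τ̂_n/(n p̂_n(1 − p̂_n)))` WITH ASYMPTOTICALLY
NOMINAL PROBABILITY, FROM EVERY INITIAL STATE** (Crooks pair, level samplers leaving `ν₀, ν₁`
invariant, `ε • ν ≤ nHit Q 2 z`, `ε ≠ 0`, `e^{−ΔF} = Z₁/Z₀`, `τ_int(ρ_occ) > 0`; windows `W_n → ∞`,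
`W_n³/n → 0`; `z > 0`). -/
theorem CrooksPair.ncmc_dFocc_mem_gammaInterval_of_sq (h : CrooksPair ν₀ ν₁ κF κR s e W)
    (h0 : ν₀ univ ≠ 0) (h1 : ν₁ univ ≠ 0) (hT₀ : Kernel.Invariant T₀ ν₀)
    (hT₁ : Kernel.Invariant T₁ ν₁) (hε : ε ≠ 0)
    (hD : haveI := isMarkovKernel_switchKernel (κF := κF) (κR := κR) (c := c)
              h.measurable_W h.measurable_s h.measurable_e
      ∀ z, ε • ν ≤ nHit (switchKernel κF κR c W s e ∘ₖ levelKernel T₀ T₁) 2 z)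
    {ΔF : ℝ} (hΔF : Real.exp (-ΔF) = ((ν₀ univ)⁻¹ * ν₁ univ).toReal)
    (hτ : haveI := isMarkovKernel_switchKernel (κF := κF) (κR := κR) (c := c)
              h.measurable_W h.measurable_s h.measurable_e
      0 < Scoring.tauInt (setACF (switchKernel κF κR c W s e ∘ₖ levelKernel T₀ T₁)
        ((jointWeight c ν₀ ν₁ univ)⁻¹ • jointWeight c ν₀ ν₁) (targetLevel Ω)))
    {Wn : ℕ → ℕ} (hW : Tendsto Wn atTop atTop) (hW3 : Tendsto (fun N => (Wn N : ℝ) ^ 3 / N) atTop (𝓝 0))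
    (z₀ : Bool × Ω) {z : ℝ} (hz : 0 < z)
    [hP : haveI := isMarkovKernel_switchKernel (κF := κF) (κR := κR) (c := c)
              h.measurable_W h.measurable_s h.measurable_e
      haveI := isMarkovKernel_levelKernel T₀ T₁
      IsProbabilityMeasure (Kernel.trajMeasure (X := fun _ : ℕ => Bool × Ω) (Measure.dirac z₀)
        (fun n : ℕ => (switchKernel κF κR c W s e ∘ₖ levelKernel T₀ T₁).comap
          (fun hh : (j : ↥(Finset.Iic n)) → Bool × Ω => hh ⟨n, Finset.mem_Iic.2 le_rfl⟩)
          (measurable_pi_apply _)))] :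
    haveI := isMarkovKernel_switchKernel (κF := κF) (κR := κR) (c := c)
      h.measurable_W h.measurable_s h.measurable_e
    haveI := isMarkovKernel_levelKernel T₀ T₁
    Tendsto (fun n : ℕ => (Kernel.trajMeasure (X := fun _ : ℕ => Bool × Ω) (Measure.dirac z₀)
        (fun n : ℕ => (switchKernel κF κR c W s e ∘ₖ levelKernel T₀ T₁).comap
          (fun hh : (j : ↥(Finset.Iic n)) → Bool × Ω => hh ⟨n, Finset.mem_Iic.2 le_rfl⟩)
          (measurable_pi_apply _)))
        {x : ℕ → Bool × Ω | |(c - Real.log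
            ((∑ i ∈ range n, (targetLevel Ω).indicator (1 : Bool × Ω → ℝ) (x i)) / n /
              (1 - (∑ i ∈ range n, (targetLevel Ω).indicator (1 : Bool × Ω → ℝ) (x i)) / n)))
            - ΔF|
          ≤ z * Real.sqrt (2 * Scoring.tauIntWindow (Scoring.rhoHat
              (fun i => (targetLevel Ω).indicator (1 : Bool × Ω → ℝ) (x i)) n) (Wn n)
            / (n * ((∑ i ∈ range n, (targetLevel Ω).indicator (1 : Bool × Ω → ℝ) (x i)) / n
              * (1 - (∑ i ∈ range n, (targetLevel Ω).indicator (1 : Bool × Ω → ℝ) (x i)) / n))))})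
      atTop (𝓝 (gaussianReal 0 1 (Icc (-z) z))) := by
  haveI := isMarkovKernel_switchKernel (κF := κF) (κR := κR) (c := c)
    h.measurable_W h.measurable_s h.measurable_e
  haveI := isMarkovKernel_levelKernel T₀ T₁
  set P := Kernel.trajMeasure (X := fun _ : ℕ => Bool × Ω) (Measure.dirac z₀)
    (fun n : ℕ => (switchKernel κF κR c W s e ∘ₖ levelKernel T₀ T₁).comap
      (fun hh : (j : ↥(Finset.Iic n)) → Bool × Ω => hh ⟨n, Finset.mem_Iic.2 le_rfl⟩)
      (measurable_pi_apply _)) with hPdef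
  set τ : ℝ := Scoring.tauInt (setACF (switchKernel κF κR c W s e ∘ₖ levelKernel T₀ T₁)
    ((jointWeight c ν₀ ν₁ univ)⁻¹ • jointWeight c ν₀ ν₁) (targetLevel Ω)) with hτdef
  set σ : ℝ := Real.sigmoid (c - ΔF) with hσdef
  have hσ0 : 0 < σ := Real.sigmoid_pos _
  have hσ1 : σ < 1 := Real.sigmoid_lt_one _
  have hv0 : 0 < σ * (1 - σ) := mul_pos hσ0 (sub_pos.2 hσ1)
  -- the studentized coverage (E), the consistency of `τ̂` (T) and the LLN of the occupancy (A)
  have hE := h.ncmc_dFocc_coverage_gamma_of_sq h0 h1 hT₀ hT₁ hε hD hΔF hτ hW hW3 z₀ hz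
  have hT := h.ncmc_tauIntWindow_occupancy_tendstoInMeasure_of_sq h0 h1 hT₀ hT₁ hε hD hΔF hW hW3 z₀
  have hfreq := h.ncmc_occupancy_everyStart_of_sq h0 h1 hT₀ hT₁ hε hD hΔF z₀
  rw [← hPdef] at hE hT hfreq
  -- abbreviations
  have hg : Measurable ((targetLevel Ω).indicator (1 : Bool × Ω → ℝ)) :=
    measurable_one.indicator measurableSet_targetLevel
  have hpm : ∀ n : ℕ, Measurable fun x : ℕ → Bool × Ω =>
      (∑ i ∈ range n, (targetLevel Ω).indicator (1 : Bool × Ω → ℝ) (x i)) / n := fun n =>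
    (Finset.measurable_sum _ fun i _ => hg.comp (measurable_pi_apply i)).div_const _
  have hA : TendstoInMeasure P (fun (n : ℕ) (x : ℕ → Bool × Ω) =>
      (∑ i ∈ range n, (targetLevel Ω).indicator (1 : Bool × Ω → ℝ) (x i)) / n
        * (1 - (∑ i ∈ range n, (targetLevel Ω).indicator (1 : Bool × Ω → ℝ) (x i)) / n))
      atTop (fun _ => σ * (1 - σ)) := by
    refine tendstoInMeasure_of_tendsto_ae (fun n => ((hpm n).mul
      (measurable_const.sub (hpm n))).aestronglyMeasurable) ?_
    filter_upwards [hfreq] with x hx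
    exact hx.mul (tendsto_const_nhds.sub hx)
  -- the vanishing event: `τ̂ ≤ 0` or `p̂(1 − p̂) ≤ 0` or `n = 0`
  have hBt : Tendsto (fun n : ℕ => P ({x : ℕ → Bool × Ω | Scoring.tauIntWindow (Scoring.rhoHat
        (fun i => (targetLevel Ω).indicator (1 : Bool × Ω → ℝ) (x i)) n) (Wn n) ≤ 0}
      ∪ ({x | (∑ i ∈ range n, (targetLevel Ω).indicator (1 : Bool × Ω → ℝ) (x i)) / n
        * (1 - (∑ i ∈ range n, (targetLevel Ω).indicator (1 : Bool × Ω → ℝ) (x i)) / n) ≤ 0}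
      ∪ {x | n = 0}))) atTop (𝓝 0) := by
    have h1 : Tendsto (fun n : ℕ => P {x : ℕ → Bool × Ω | Scoring.tauIntWindow (Scoring.rhoHat
        (fun i => (targetLevel Ω).indicator (1 : Bool × Ω → ℝ) (x i)) n) (Wn n) ≤ 0}) atTop (𝓝 0) := by
      have h := hT (ENNReal.ofReal τ) (by simpa using hτ)
      refine tendsto_of_tendsto_of_tendsto_of_le_of_le tendsto_const_nhds h (fun n => bot_le)
        fun n => measure_mono fun x hx => ?_
      simp only [Set.mem_setOf_eq] at hx ⊢
      rw [edist_dist, Real.dist_eq, abs_sub_comm]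
      exact ENNReal.ofReal_le_ofReal (by linarith [le_abs_self (τ - Scoring.tauIntWindow
        (Scoring.rhoHat (fun i => (targetLevel Ω).indicator (1 : Bool × Ω → ℝ) (x i)) n) (Wn n))])
    have h2 : Tendsto (fun n : ℕ => P {x : ℕ → Bool × Ω |
        (∑ i ∈ range n, (targetLevel Ω).indicator (1 : Bool × Ω → ℝ) (x i)) / n
          * (1 - (∑ i ∈ range n, (targetLevel Ω).indicator (1 : Bool × Ω → ℝ) (x i)) / n) ≤ 0})
        atTop (𝓝 0) := by
      have h := hA (ENNReal.ofReal (σ * (1 - σ))) (by simpa using hv0)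
      refine tendsto_of_tendsto_of_tendsto_of_le_of_le tendsto_const_nhds h (fun n => bot_le)
        fun n => measure_mono fun x hx => ?_
      simp only [Set.mem_setOf_eq] at hx ⊢
      rw [edist_dist, Real.dist_eq, abs_sub_comm]
      exact ENNReal.ofReal_le_ofReal (by linarith [le_abs_self (σ * (1 - σ) -
        (∑ i ∈ range n, (targetLevel Ω).indicator (1 : Bool × Ω → ℝ) (x i)) / n
          * (1 - (∑ i ∈ range n, (targetLevel Ω).indicator (1 : Bool × Ω → ℝ) (x i)) / n))])
    have h3 : Tendsto (fun n : ℕ => P {x : ℕ → Bool × Ω | n = 0}) atTop (𝓝 0) := by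
      refine tendsto_const_nhds.congr' ?_
      filter_upwards [Filter.eventually_gt_atTop 0] with n hn
      rw [show {x : ℕ → Bool × Ω | n = 0} = ∅ from Set.eq_empty_of_forall_notMem fun x hx => hn.ne' hx,
        measure_empty]
    have h := h1.add (h2.add h3)
    rw [add_zero, add_zero] at h
    exact tendsto_of_tendsto_of_tendsto_of_le_of_le tendsto_const_nhds h (fun n => bot_le)
      fun n => (measure_union_le _ _).trans (add_le_add le_rfl (measure_union_le _ _))
  refine tendsto_measure_of_eq_off_vanishing hBt (fun n => ?_) hE
  ext x
  simp only [Set.mem_inter_iff, Set.mem_compl_iff, Set.mem_union, Set.mem_setOf_eq, not_or, not_le]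
  constructor
  · rintro ⟨h, hτpos, hapos, hn⟩
    exact ⟨(abs_scaled_le_iff (Nat.pos_of_ne_zero hn) hapos hτpos).1 h, hτpos, hapos, hn⟩
  · rintro ⟨h, hτpos, hapos, hn⟩
    exact ⟨(abs_scaled_le_iff (Nat.pos_of_ne_zero hn) hapos hτpos).2 h, hτpos, hapos, hn⟩

end NCMC

end Summit.Ventures.LatticeQCDFlow.Exactness.GeneralNCMC
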